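import Mathlib.LinearAlgebra.Matrix.Determinant.Basic
import Mathlib.Topology.Instances.Matrix
import Mathlib.Topology.Algebra.Order.Field
import Mathlib.Order.Filter.Finite
import Literature.Analysis.TotalPositivity.MultiplyPositive
import Literature.Analysis.TotalPositivity.FeketeCriterion
import HarnessLib

/-!
# The solid-minor criterion for `PF_m` (Katkova–Ostrovskii's Lemma 3) — proved

Trunk T-ANALYSIS (Literature/Analysis/TotalPositivity). For a ONE-SIDED real sequence
`(a_k)_{k ≥ 0}` (`a_k = 0` for `k < 0`) the Toeplitz matrix `(a_{i-j})_{i,j ≥ 0}` is lower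
triangular, so Fekete's criterion [Katkova2006, §2 Thm. D; tree:
`det_submatrix_pos_of_contiguous`] — "all minors composed of consecutive rows and consecutive
columns are positive ⟹ all minors are positive" — never applies to it verbatim: every contiguous
block lying above the diagonal has determinant `0`. What one CAN ask of a one-sided sequence is
positivity of the *solid* minors

  `T_ν(k) := det (a_{k+i-j})_{i,j < ν}`, `k ≥ 0`, `1 ≤ ν ≤ m`

(rows `k, …, k+ν-1`, columns `0, …, ν-1`; for `k < ν - 1` some entries are `a_{<0} = 0`). This is
the criterion Katkova uses to conclude her Theorem 3 [Katkova2006, §2, Lemma 3 (quoted from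
Katkova–Ostrovskii 1990), arXiv pp. 5–6]: "Suppose that for every `ν = 1, …, m` … all minors of
order `ν` [of the `ν × ∞` matrix `(a_{j-i})_{i<ν, j≥0}`], composed of consecutive columns, are
positive. Then `{a_k} ∈ PF_m`." (The minor of `(a_{j-i})_{i<ν,j≥0}` on the columns
`k, …, k+ν-1` is `det (a_{k+j-i}) = det (a_{k+i-j}) = T_ν(k)` by transposition; the printed lemma
also assumes `a_k > 0` — which is `T_1(k) > 0` — and `Σ a_k < ∞`, which is not needed here.)

## The proof (perturbation + Fekete)

Fix a target minor (rows `r`, columns `c`, order `≤ m`) and a square section of size `N`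
containing it. For `t > 0` replace the zero corner by a Gaussian: `A^t_{ij} = a_{i-j}` for
`i ≥ j` and `A^t_{ij} = t^{(j-i)²}` for `i < j` (`pertMatrix`). Every contiguous `ν × ν` block of
`A^t`, `ν ≤ m`, has positive determinant for all small `t > 0`:
* a block at offset `k = i₀ - j₀ ≥ 0` tends, as `t → 0`, to the solid minor `T_ν(k) > 0`;
* a block at offset `-κ = i₀ - j₀ < 0` is `t^{νκ²} (1 + O(t))`: in the Leibniz expansion the
  identity permutation contributes `∏ t^{κ²} = t^{νκ²}` and every other permutation `σ` a term
  `± (∏ a's) t^{E(σ)}` with `E(σ) = Σ_{i : κ+i-σ(i) ≥ 1} (κ+i-σ(i))² ≥ νκ² + 1`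
  (`exponent_lower_bound`: sum `e_i ≥ 2κ(κ+i-σ i) - κ² + [σ i ≠ i]` over `i`, using
  `Σ (i - σ i) = 0`).
So by Fekete's criterion all minors of `A^t` of order `≤ m` are positive for small `t > 0`, and
letting `t → 0⁺` the target minor of `A^0 =` (the Toeplitz section) is `≥ 0`.

## Main statements

* `solidMinor a ν k = toeplitzMinor a (k, k+1, …, k+ν-1) (0, 1, …, ν-1)`.
* `isMultiplyPositiveSeq_of_solidMinor_pos` : `(∀ 1 ≤ ν ≤ m, ∀ k, 0 < T_ν(k)) → PF_m`.

## References

* O. M. Katkova, *Multiple positivity and the Riemann zeta-function*, CMFT 7 (2007) 13–31;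
  arXiv:math/0505174, §2, Lemma 3 and Thm. D. [Katkova2006]
* O. M. Katkova, I. V. Ostrovskii, *Zero sets of entire generating functions of Pólya
  frequency sequences of finite order*, Math. USSR-Izv. 35 (1990) 101–112 (Katkova's [katos]).
* S. M. Fallat, C. R. Johnson, *Totally Nonnegative Matrices*, Princeton UP 2011, Cor. 3.1.5–6.
  [FallatJohnson2011]
-/

noncomputable section

open Filter Matrix Finset
open scoped Topology

namespace Literature.Analysis.TotalPositivity

/-! ### Solid minors -/

/-- The **solid Toeplitz minor** `T_ν(k) = det (a_{k+i-j})_{i,j<ν}` of a one-sided sequence: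
rows `k, …, k+ν-1` and columns `0, …, ν-1` of `(a_{i-j})_{i,j≥0}` (`a_n = 0` for `n < 0`).
Katkova's `A_k^ν = det (a_{k+j-l})_{l,j<ν}` [Katkova2006, §2 eq. (7)] is the same number
(transpose). [cite: Katkova2006, §2 eq. (7)] -/
def solidMinor (a : ℕ → ℝ) (ν k : ℕ) : ℝ :=
  toeplitzMinor a (fun i : Fin ν => k + (i : ℕ)) (fun j : Fin ν => (j : ℕ))

/-- `seqZ a (i - j)` for naturals `i, j` (a private copy of the lemma of the same name in
`PolyaFrequencyDeflation.lean`, to keep the imports light). [folklore] -/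
private theorem seqZ_sub_eq_ite (a : ℕ → ℝ) (i j : ℕ) :
    seqZ a ((i : ℤ) - j) = if j ≤ i then a (i - j) else 0 := by
  split_ifs with h
  · have : ((i : ℤ) - (j : ℤ)) = ((i - j : ℕ) : ℤ) := by push_cast [h]; ring
    rw [this, seqZ_natCast]
  · exact seqZ_of_neg a (by push Not at h; omega)

/-- The order-`0` solid minor is `1`. [folklore] -/
theorem solidMinor_zero (a : ℕ → ℝ) (k : ℕ) : solidMinor a 0 k = 1 := by
  simp [solidMinor, toeplitzMinor, Matrix.det_isEmpty]

/-! ### The Gaussian corner perturbation -/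

/-- Entry `(i, j)` of the perturbed section: `a_{i-j}` on and below the diagonal, `t^{(j-i)²}`
above it. [folklore] -/
def pertEntry (a : ℕ → ℝ) (t : ℝ) (i j : ℕ) : ℝ :=
  if j ≤ i then a (i - j) else t ^ ((j - i) ^ 2)

/-- The perturbed `N × N` section `A^t`. [folklore] -/
def pertMatrix (a : ℕ → ℝ) (t : ℝ) (N : ℕ) : Matrix (Fin N) (Fin N) ℝ :=
  Matrix.of fun i j => pertEntry a t i j

/-- At `t = 0` the perturbation disappears: `A^0_{ij} = a_{i-j}` (`= 0` above the diagonal).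
[folklore] -/
theorem pertEntry_zero (a : ℕ → ℝ) (i j : ℕ) : pertEntry a 0 i j = seqZ a ((i : ℤ) - j) := by
  rw [seqZ_sub_eq_ite, pertEntry]
  split_ifs with h
  · rfl
  · apply zero_pow
    push Not at h
    exact pow_ne_zero _ (by omega)

/-- `t ↦ A^t_{ij}` is continuous. [folklore] -/
theorem continuous_pertEntry (a : ℕ → ℝ) (i j : ℕ) : Continuous fun t => pertEntry a t i j := by
  unfold pertEntry
  split_ifs
  · exact continuous_const
  · exact continuous_pow _

/-- The contiguous `ν × ν` block of `A^t` at position `(i₀, j₀)`. [folklore] -/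
def pertBlock (a : ℕ → ℝ) (t : ℝ) (ν i₀ j₀ : ℕ) : Matrix (Fin ν) (Fin ν) ℝ :=
  Matrix.of fun i j => pertEntry a t (i₀ + i) (j₀ + j)

/-- `t ↦ det (block of A^t)` is continuous. [folklore] -/
theorem continuous_det_pertBlock (a : ℕ → ℝ) (ν i₀ j₀ : ℕ) :
    Continuous fun t => (pertBlock a t ν i₀ j₀).det := by
  refine Continuous.matrix_det ?_
  exact continuous_pi fun i => continuous_pi fun j => continuous_pertEntry a _ _

/-- A block at offset `k = i₀ - j₀ ≥ 0` is, at `t = 0`, the solid minor `T_ν(k)`. [folklore] -/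
theorem det_pertBlock_zero_of_le (a : ℕ → ℝ) (ν : ℕ) {i₀ j₀ : ℕ} (h : j₀ ≤ i₀) :
    (pertBlock a 0 ν i₀ j₀).det = solidMinor a ν (i₀ - j₀) := by
  unfold pertBlock solidMinor toeplitzMinor
  congr 1
  ext i j
  simp only [Matrix.of_apply, pertEntry_zero]
  congr 1
  push_cast [h]
  ring

/-! ### Blocks above the diagonal: the identity permutation dominates -/

/-- The exponent of `t` contributed by entry `(σ i, i)` of a block at offset `-κ < 0`:
`0` for an entry on/below the diagonal of `A`, `(κ + i - σ i)²` above it. [folklore] -/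
def pertExp {ν : ℕ} (κ : ℕ) (σ : Equiv.Perm (Fin ν)) (i : Fin ν) : ℕ :=
  if κ + (i : ℕ) ≤ (σ i : ℕ) then 0 else (κ + (i : ℕ) - (σ i : ℕ)) ^ 2

/-- **Key combinatorial inequality**: for `σ ≠ 1` the total exponent exceeds `νκ²`.
Pointwise `e_i ≥ 2κ(κ + i - σ i) - κ² + [σ i ≠ i]`, and `Σ_i (i - σ i) = 0`. [folklore] -/
theorem exponent_lower_bound {ν : ℕ} {κ : ℕ} (hκ : 1 ≤ κ) {σ : Equiv.Perm (Fin ν)}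
    (hσ : σ ≠ 1) : ν * κ ^ 2 + 1 ≤ ∑ i : Fin ν, pertExp κ σ i := by
  -- pass to `ℤ`
  have hpt : ∀ i : Fin ν, (2 * (κ : ℤ) * ((κ : ℤ) + (i : ℕ) - (σ i : ℕ)) - (κ : ℤ) ^ 2
      + (if σ i = i then 0 else 1)) ≤ (pertExp κ σ i : ℤ) := by
    intro i
    unfold pertExp
    have hκ2 : (1 : ℤ) ≤ (κ : ℤ) ^ 2 := by
      have : (1 : ℤ) ≤ κ := by exact_mod_cast hκ
      nlinarith
    by_cases hle : κ + (i : ℕ) ≤ (σ i : ℕ)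
    · rw [if_pos hle]
      have h1 : (κ : ℤ) + (i : ℕ) - (σ i : ℕ) ≤ 0 := by omega
      have hκ0 : (0 : ℤ) ≤ κ := by positivity
      split_ifs <;> push_cast <;> nlinarith
    · rw [if_neg hle]
      push Not at hle
      have hcast : (((κ + (i : ℕ) - (σ i : ℕ)) ^ 2 : ℕ) : ℤ) = ((κ : ℤ) + (i : ℕ) - (σ i : ℕ)) ^ 2 := by
        have : (σ i : ℕ) ≤ κ + (i : ℕ) := hle.le
        push_cast [this]
        ring
      rw [hcast]
      split_ifs with hfix
      · nlinarith [sq_nonneg ((κ : ℤ) + (i : ℕ) - (σ i : ℕ) - κ)]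
      · have hne : ((i : ℕ) : ℤ) - (σ i : ℕ) ≠ 0 := by
          intro h0
          apply hfix
          exact Fin.ext (by omega)
        have hsq : 1 ≤ (((i : ℕ) : ℤ) - (σ i : ℕ)) ^ 2 := by
          have := sq_pos_of_ne_zero hne
          omega
        nlinarith [hsq]
  have hsum := Finset.sum_le_sum fun i (_ : i ∈ (univ : Finset (Fin ν))) => hpt i
  -- evaluate the left-hand side
  have hperm : ∑ i : Fin ν, ((σ i : ℕ) : ℤ) = ∑ i : Fin ν, ((i : ℕ) : ℤ) :=
    Equiv.sum_comp σ (fun i : Fin ν => ((i : ℕ) : ℤ))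
  have hlin : ∑ i : Fin ν, (2 * (κ : ℤ) * ((κ : ℤ) + (i : ℕ) - (σ i : ℕ)) - (κ : ℤ) ^ 2) =
      ν * (κ : ℤ) ^ 2 := by
    have h1 : ∑ i : Fin ν, (2 * (κ : ℤ) * ((κ : ℤ) + (i : ℕ) - (σ i : ℕ)) - (κ : ℤ) ^ 2)
        = ∑ i : Fin ν, ((κ : ℤ) ^ 2 + (2 * κ * ((i : ℕ) : ℤ) - 2 * κ * ((σ i : ℕ) : ℤ))) :=
      Finset.sum_congr rfl fun i _ => by ring
    rw [h1, Finset.sum_add_distrib, Finset.sum_sub_distrib, ← Finset.mul_sum, ← Finset.mul_sum,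
      hperm]
    simp
  have hind : (1 : ℤ) ≤ ∑ i : Fin ν, (if σ i = i then (0 : ℤ) else 1) := by
    obtain ⟨i, hi⟩ : ∃ i, σ i ≠ i := by
      by_contra hcon
      push Not at hcon
      exact hσ (Equiv.ext hcon)
    have h1 : (if σ i = i then (0 : ℤ) else 1) ≤ ∑ j : Fin ν, (if σ j = j then (0 : ℤ) else 1) :=
      Finset.single_le_sum (f := fun j => if σ j = j then (0 : ℤ) else 1)
        (fun j _ => by split_ifs <;> norm_num) (mem_univ i)
    rw [if_neg hi] at h1
    exact h1
  have htot : (ν : ℤ) * (κ : ℤ) ^ 2 + 1 ≤ ∑ i : Fin ν, (pertExp κ σ i : ℤ) := by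
    rw [Finset.sum_add_distrib, hlin] at hsum
    linarith
  exact_mod_cast htot

/-- Entries of a block above the diagonal (offset `-κ`, `κ = j₀ - i₀ ≥ 1`): entry `(σ i, i)` is
`a_{…}` when `κ + i ≤ σ i` and `t^{(κ+i-σ i)²}` otherwise. [folklore] -/
theorem pertBlock_apply_of_lt (a : ℕ → ℝ) (t : ℝ) {ν i₀ j₀ : ℕ} (h : i₀ < j₀)
    (σ : Equiv.Perm (Fin ν)) (i : Fin ν) :
    pertBlock a t ν i₀ j₀ (σ i) i =
      if (j₀ - i₀) + (i : ℕ) ≤ (σ i : ℕ) then a (i₀ + σ i - (j₀ + i))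
        else t ^ pertExp (j₀ - i₀) σ i := by
  simp only [pertBlock, Matrix.of_apply, pertEntry, pertExp]
  by_cases hle : (j₀ - i₀) + (i : ℕ) ≤ (σ i : ℕ)
  · rw [if_pos (by omega), if_pos hle]
  · rw [if_neg (by omega), if_neg hle, if_neg hle]
    congr 2
    omega

/-- **A block above the diagonal has positive determinant for small `t > 0`.** With
`A := 1 + Σ_{l<N} |a_l|` bounding the entries, `det = t^{νκ²} + Σ_{σ ≠ 1} ± (…) t^{E(σ)}` and each
of the `ν! - 1` error terms is at most `A^ν t^{νκ²+1}` in absolute value for `0 < t ≤ 1`.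
[folklore] -/
theorem det_pertBlock_pos_of_lt (a : ℕ → ℝ) {ν i₀ j₀ N : ℕ} (h : i₀ < j₀) (hN : i₀ + ν ≤ N) :
    ∀ᶠ t in 𝓝[>] (0 : ℝ), 0 < (pertBlock a t ν i₀ j₀).det := by
  set κ := j₀ - i₀ with hκdef
  have hκ : 1 ≤ κ := by omega
  set A : ℝ := 1 + ∑ l ∈ Finset.range N, |a l| with hA
  have hA1 : 1 ≤ A := by
    have : 0 ≤ ∑ l ∈ Finset.range N, |a l| := Finset.sum_nonneg fun l _ => abs_nonneg _
    linarith
  have hAl : ∀ l, l < N → |a l| ≤ A := fun l hl => by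
    have : |a l| ≤ ∑ l ∈ Finset.range N, |a l| :=
      Finset.single_le_sum (f := fun l => |a l|) (fun _ _ => abs_nonneg _) (Finset.mem_range.2 hl)
    linarith
  set C : ℝ := (Nat.factorial ν : ℝ) * A ^ ν with hC
  have hCpos : 0 < C := by positivity
  -- for `0 < t < min 1 (1/C)` the determinant is positive
  have hmem : Set.Ioo (0 : ℝ) (min 1 C⁻¹) ∈ 𝓝[>] (0 : ℝ) :=
    Ioo_mem_nhdsGT (lt_min one_pos (inv_pos.2 hCpos))
  filter_upwards [hmem] with t ht
  obtain ⟨ht0, ht1⟩ := ht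
  have ht1' : t ≤ 1 := (lt_min_iff.1 ht1).1.le
  have htC : t * C < 1 := by
    have h1 : t < C⁻¹ := (lt_min_iff.1 ht1).2
    calc t * C < C⁻¹ * C := mul_lt_mul_of_pos_right h1 hCpos
      _ = 1 := inv_mul_cancel₀ hCpos.ne'
  -- Leibniz expansion, identity term separated
  rw [Matrix.det_apply, ← Finset.add_sum_erase _ _ (Finset.mem_univ (1 : Equiv.Perm (Fin ν)))]
  have hmain : Equiv.Perm.sign (1 : Equiv.Perm (Fin ν)) • ∏ i : Fin ν,
      pertBlock a t ν i₀ j₀ ((1 : Equiv.Perm (Fin ν)) i) i = t ^ (ν * κ ^ 2) := by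
    rw [Equiv.Perm.sign_one, one_smul]
    have hii : ∀ i : Fin ν, pertBlock a t ν i₀ j₀ ((1 : Equiv.Perm (Fin ν)) i) i = t ^ κ ^ 2 := by
      intro i
      rw [pertBlock_apply_of_lt a t h]
      simp only [Equiv.Perm.coe_one, id_eq]
      rw [if_neg (by omega)]
      simp only [pertExp, Equiv.Perm.coe_one, id_eq]
      rw [if_neg (by omega), ← hκdef]
      congr 2
      omega
    rw [Finset.prod_congr rfl fun i _ => hii i, Finset.prod_const, Finset.card_univ,
      Fintype.card_fin, ← pow_mul, mul_comm]
  -- each error term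
  have herr : ∀ σ ∈ (Finset.univ : Finset (Equiv.Perm (Fin ν))).erase 1,
      |Equiv.Perm.sign σ • ∏ i : Fin ν, pertBlock a t ν i₀ j₀ (σ i) i| ≤
        A ^ ν * t ^ (ν * κ ^ 2 + 1) := by
    intro σ hσ
    have hσ1 : σ ≠ 1 := Finset.ne_of_mem_erase hσ
    have habs : |Equiv.Perm.sign σ • ∏ i : Fin ν, pertBlock a t ν i₀ j₀ (σ i) i| =
        ∏ i : Fin ν, |pertBlock a t ν i₀ j₀ (σ i) i| := by
      rw [← Finset.abs_prod]
      rcases Int.units_eq_one_or (Equiv.Perm.sign σ) with h1 | h1 <;> simp [h1]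
    rw [habs]
    have hent : ∀ i : Fin ν, |pertBlock a t ν i₀ j₀ (σ i) i| ≤ A * t ^ pertExp κ σ i := by
      intro i
      rw [pertBlock_apply_of_lt a t h, ← hκdef]
      by_cases hle : κ + (i : ℕ) ≤ (σ i : ℕ)
      · rw [if_pos hle]
        have he : pertExp κ σ i = 0 := by simp [pertExp, hle]
        rw [he, pow_zero, mul_one]
        exact hAl _ (by omega)
      · rw [if_neg hle, abs_of_nonneg (pow_nonneg ht0.le _)]
        have : 0 ≤ t ^ pertExp κ σ i := pow_nonneg ht0.le _
        nlinarith
    calc ∏ i : Fin ν, |pertBlock a t ν i₀ j₀ (σ i) i|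
        ≤ ∏ i : Fin ν, (A * t ^ pertExp κ σ i) :=
          Finset.prod_le_prod (fun i _ => abs_nonneg _) fun i _ => hent i
      _ = A ^ ν * t ^ (∑ i : Fin ν, pertExp κ σ i) := by
          rw [Finset.prod_mul_distrib, Finset.prod_const, Finset.card_univ, Fintype.card_fin,
            Finset.prod_pow_eq_pow_sum]
      _ ≤ A ^ ν * t ^ (ν * κ ^ 2 + 1) :=
          mul_le_mul_of_nonneg_left
            (pow_le_pow_of_le_one ht0.le ht1' (exponent_lower_bound hκ hσ1))
            (pow_nonneg (zero_le_one.trans hA1) _)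
  -- sum up
  have hsumerr : |∑ σ ∈ (Finset.univ : Finset (Equiv.Perm (Fin ν))).erase 1,
      Equiv.Perm.sign σ • ∏ i : Fin ν, pertBlock a t ν i₀ j₀ (σ i) i| ≤
        C * t ^ (ν * κ ^ 2 + 1) := by
    refine (Finset.abs_sum_le_sum_abs _ _).trans ?_
    refine (Finset.sum_le_sum herr).trans ?_
    rw [Finset.sum_const, nsmul_eq_mul, hC]
    have hcard : (((Finset.univ : Finset (Equiv.Perm (Fin ν))).erase 1).card : ℝ) ≤ Nat.factorial ν := by
      have h1 := Finset.card_erase_le (s := (Finset.univ : Finset (Equiv.Perm (Fin ν)))) (a := 1)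
      rw [Finset.card_univ, Fintype.card_perm, Fintype.card_fin] at h1
      exact_mod_cast h1
    have h2 : 0 ≤ A ^ ν * t ^ (ν * κ ^ 2 + 1) := by positivity
    nlinarith
  have hlow : t ^ (ν * κ ^ 2) - C * t ^ (ν * κ ^ 2 + 1) ≤
      t ^ (ν * κ ^ 2) + ∑ σ ∈ (Finset.univ : Finset (Equiv.Perm (Fin ν))).erase 1,
        Equiv.Perm.sign σ • ∏ i : Fin ν, pertBlock a t ν i₀ j₀ (σ i) i := by
    have := neg_abs_le (∑ σ ∈ (Finset.univ : Finset (Equiv.Perm (Fin ν))).erase 1,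
      Equiv.Perm.sign σ • ∏ i : Fin ν, pertBlock a t ν i₀ j₀ (σ i) i)
    linarith
  rw [hmain]
  refine lt_of_lt_of_le ?_ hlow
  have htpow : 0 < t ^ (ν * κ ^ 2) := pow_pos ht0 _
  have hsplit : t ^ (ν * κ ^ 2 + 1) = t ^ (ν * κ ^ 2) * t := pow_succ _ _
  rw [hsplit]
  nlinarith [mul_pos htpow (sub_pos.2 htC)]

/-- **Every contiguous block of `A^t` of order `ν ≤ m` is positive for small `t > 0`**, given the
solid minors `T_ν(k) > 0`: blocks above the diagonal by `det_pertBlock_pos_of_lt`, the others by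
continuity from `det (block of A^0) = T_ν(i₀ - j₀) > 0`. [folklore] -/
theorem eventually_det_pertBlock_pos {m : ℕ} {a : ℕ → ℝ}
    (h : ∀ ν, 1 ≤ ν → ν ≤ m → ∀ k : ℕ, 0 < solidMinor a ν k) {ν i₀ j₀ N : ℕ} (hν : ν ≤ m)
    (hi : i₀ + ν ≤ N) : ∀ᶠ t in 𝓝[>] (0 : ℝ), 0 < (pertBlock a t ν i₀ j₀).det := by
  rcases Nat.eq_zero_or_pos ν with rfl | hν1
  · exact Eventually.of_forall fun t => by simp [Matrix.det_isEmpty]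
  rcases lt_or_ge i₀ j₀ with hlt | hle
  · exact det_pertBlock_pos_of_lt a hlt hi
  · have h0 : 0 < (pertBlock a 0 ν i₀ j₀).det := by
      rw [det_pertBlock_zero_of_le a ν hle]
      exact h ν hν1 hν _
    have := ((continuous_det_pertBlock a ν i₀ j₀).tendsto 0).eventually_const_lt h0
    exact this.filter_mono nhdsWithin_le_nhds

/-! ### The criterion -/

/-- **The solid-minor criterion (Katkova–Ostrovskii's Lemma 3).** If every solid Toeplitz minor
`T_ν(k) = det (a_{k+i-j})_{i,j<ν}`, `1 ≤ ν ≤ m`, `k ≥ 0`, of a one-sided real sequence is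
positive, then the sequence is `m`-times positive (`PF_m`). [Katkova2006, §2 Lemma 3, quoting
Katkova–Ostrovskii, Math. USSR-Izv. 35 (1990), without the hypothesis `Σ a_k < ∞`.] Proof: Fekete's
criterion (`det_submatrix_pos_of_contiguous`) for the Gaussian corner perturbation `A^t`, then
`t → 0⁺`. [cite: Katkova2006, §2 Lemma 3] -/
theorem isMultiplyPositiveSeq_of_solidMinor_pos {m : ℕ} {a : ℕ → ℝ}
    (h : ∀ ν, 1 ≤ ν → ν ≤ m → ∀ k : ℕ, 0 < solidMinor a ν k) : IsMultiplyPositiveSeq m a := by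
  intro n hn r c hr hc
  -- a square section containing the minor
  set N : ℕ := (∑ i, r i) + (∑ j, c j) + 1 with hN
  have hrN : ∀ i, r i < N := fun i => by
    have : r i ≤ ∑ i, r i := Finset.single_le_sum (f := r) (fun _ _ => Nat.zero_le _) (mem_univ i)
    omega
  have hcN : ∀ j, c j < N := fun j => by
    have : c j ≤ ∑ j, c j := Finset.single_le_sum (f := c) (fun _ _ => Nat.zero_le _) (mem_univ j)
    omega
  set r' : Fin n → Fin N := fun i => ⟨r i, hrN i⟩ with hr'
  set c' : Fin n → Fin N := fun j => ⟨c j, hcN j⟩ with hc'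
  have hr'm : StrictMono r' := fun i j hij => Fin.mk_lt_mk.2 (hr hij)
  have hc'm : StrictMono c' := fun i j hij => Fin.mk_lt_mk.2 (hc hij)
  -- all contiguous blocks of order `≤ m` are positive for small `t > 0`
  have hblocks : ∀ᶠ t in 𝓝[>] (0 : ℝ),
      ∀ p ∈ (Finset.univ : Finset (Fin (m + 1) × Fin (N + 1) × Fin (N + 1))),
        (p.2.1 : ℕ) + (p.1 : ℕ) ≤ N → (p.2.2 : ℕ) + (p.1 : ℕ) ≤ N →
          0 < (pertBlock a t p.1 p.2.1 p.2.2).det := by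
    rw [Filter.eventually_all_finset]
    intro p _
    by_cases h1 : (p.2.1 : ℕ) + (p.1 : ℕ) ≤ N
    · exact (eventually_det_pertBlock_pos h (Nat.lt_succ_iff.1 p.1.2) h1).mono
        fun t ht _ _ => ht
    · exact Eventually.of_forall fun t h1' _ => absurd h1' h1
  -- hence, by Fekete's criterion, so is the target minor of `A^t`
  have hpos : ∀ᶠ t in 𝓝[>] (0 : ℝ), 0 < ((pertMatrix a t N).submatrix r' c').det := by
    filter_upwards [hblocks] with t ht
    refine det_submatrix_pos_of_contiguous (pertMatrix a t N) (fun k hk i₀ j₀ hi' hj' => ?_)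
      hn r' c' hr'm hc'm
    exact ht (⟨k, Nat.lt_succ_of_le hk⟩, ⟨i₀, by omega⟩, ⟨j₀, by omega⟩) (Finset.mem_univ _)
      hi' hj'
  -- let `t → 0⁺`
  have hcont : Continuous fun t => ((pertMatrix a t N).submatrix r' c').det :=
    Continuous.matrix_det
      (continuous_pi fun i => continuous_pi fun j => continuous_pertEntry a _ _)
  have hlim : Tendsto (fun t => ((pertMatrix a t N).submatrix r' c').det) (𝓝[>] 0)
      (𝓝 ((pertMatrix a 0 N).submatrix r' c').det) :=
    (hcont.tendsto 0).mono_left nhdsWithin_le_nhds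
  have hge : 0 ≤ ((pertMatrix a 0 N).submatrix r' c').det :=
    ge_of_tendsto hlim (hpos.mono fun t ht => ht.le)
  -- at `t = 0` this is the Toeplitz minor
  convert hge using 1
  unfold toeplitzMinor
  congr 1
  ext i j
  simp [pertMatrix, pertEntry_zero, hr', hc']

end Literature.Analysis.TotalPositivity
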